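import Summits.CriticalPhenomena.Ising3DConformalLimit.Theorems.HarmonicMomentsIsotropyTwoPointAsymptoticIsotropyOfDilutionShell
import Summits.CriticalPhenomena.Ising3DConformalLimit.Theorems.HarmonicMomentsIsotropyTwoPointAsymptoticIsotropyDilutionWindow
import Summits.CriticalPhenomena.Ising3DConformalLimit.Theorems.HarmonicMomentsIsotropyHarmonicDilution

/-!
# Vague asymptotic isotropy of the critical `ℤ³` two-point function from the route's own cruxes:
# `HarmonicDilution → CorrelationLengthWindow → TwoPointAsymptoticIsotropy`
(route HarmonicMomentsIsotropy, support item stmt-CriticalPhenomena-6036 `TwoPointAsymptoticIsotropy`)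

THE RESULT. `twoPointAsymptoticIsotropy_of_harmonicDilution_window :
HarmonicDilution → CorrelationLengthWindow → TwoPointAsymptoticIsotropy` — the glue
`DilutionTransfer` (item stmt-CriticalPhenomena-6037) WITHOUT its third hypothesis, the existence crux
`ExistsScaleCovariantLimit` (item 1981).  Hence the route's milestone `TwoPointAsymptoticIsotropy`
(item 6036) follows from the route's own items `HarmonicDilution` (6034, itself the conclusion of
`AngularHierarchy` through `HierarchyClosure`) and `CorrelationLengthWindow` (6032) alone: no scaling
limit, no scale covariance, no reflection-positivity rigidity, no regularity hypothesis on
`⟨σ₀σ_x⟩_{β_c}`.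

THE PROOF.  By the radial dilution line (`…OfDilutionShell`: `tendsto_ratio_of_dilution_core` +
`nu_cube_charge_of_nu_shell`) it suffices that the scaled subcritical measures
`ν_β = χ⁻¹ ∑ₓ G_β(x) δ_{x/ξ₂}` charge every thin Euclidean shell `{ρ₁ ≤ ‖y‖ ≤ ρ₂}` NEAR THE ORIGIN
(`ρ₂ ≤ 1/36`) uniformly as `β ↑ β_c` (`nu_shell_charge_of_window`).  This is free:
* `∫ ‖y‖² dν_β = 1` by the very definition of `ξ₂² = M₂/χ` (`integral_norm_sq_nu`), and
  `∫ ‖y‖⁴ dν_β ≤ K₄` by the uniform exponential moment from CLW (ii) (`nu_exp_moment`); since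
  `‖y‖² ≤ 1/4 + A²·1{1/2 < ‖y‖ ≤ A} + ‖y‖⁴/A²`, the annulus `{1/2 < ‖y‖ ≤ A}` has `ν_β`-mass
  `≥ 1/(2A²)` once `A² ≥ 4K₄` (`nu_annulus_ge`);
* Messager–Miracle-Solé for the free state (tree: `twoPointFree_le_single_of_le`,
  `twoPointFree_single_le_of_mul_le`): with `n₀ = ⌈3ρ₂ξ₂⌉` and `m = G_β(n₀e₁)`, every lattice point of
  the annulus (`‖x‖_∞ ≥ |x|/3 > ξ₂/6 ≥ n₀`) has `G_β ≤ m` and every point of the shell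
  (`3‖x‖_∞ ≤ 3|x| ≤ 3ρ₂ξ₂ ≤ n₀`) has `G_β ≥ m`; the annulus has at most `(2Aξ₂+1)³` points and the
  shell contains a lattice cube of side `≈ (ρ₂-ρ₁)ξ₂/4`, so
  `ν_β(shell) ≥ ((ρ₂-ρ₁)ξ₂/8)³ m/χ ≥ ((ρ₂-ρ₁)ξ₂/8)³/(2A²(3Aξ₂)³) = (ρ₂-ρ₁)³/(27648 A⁵)`.
CLW (i) is used only inside the core (window transfer); CLW (ii) gives the exponential moments and
`ξ₂ → ∞`.

References: A. Messager, S. Miracle-Solé, J. Stat. Phys. 17 (1977) 245 [MessagerMiracleSoleJSP1977];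
M. Campostrini, A. Pelissetto, P. Rossi, E. Vicari, Phys. Rev. E 57 (1998) 184, §2
[CampostriniEtAl1998]; H. Duminil-Copin, ICM 2022, §8.1 [DuminilCopinICM2022].  No definitions, no
named facts; axioms standard.
-/

noncomputable section

open MeasureTheory Filter Topology Set
open scoped ENNReal NNReal BigOperators
open Literature.Probability.LatticeModels

namespace Summit.CriticalPhenomena.Ising3DConformalLimit.Theorems.HarmonicMomentsIsotropy

open scoped Classical

/-- **`ν_β` charges every thin shell near the origin, from the window alone.** Under CLW (ii), for
`0 < ρ₁ < ρ₂ ≤ 1/36` the shell `{ρ₁ ≤ ‖y‖ ≤ ρ₂}` has `ν_β`-mass at least a fixed `ι > 0` for all `β`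
close to `β_c` (second moment one + fourth moment bounded ⇒ the unit annulus is charged,
`nu_annulus_ge`; Messager–Miracle-Solé ⇒ the two-point function on the shell dominates the two-point
function on the annulus, `nu_annulus_le_axisValue`, `axisValue_le_nu_shell`; counting lattice
points).  [cite: MessagerMiracleSoleJSP1977, main theorem (monotonicity of ⟨σ₀σ_x⟩ under reflections)] -/
theorem nu_shell_charge_of_window {c₀ C β₀ : ℝ} (hc₀ : 0 < c₀) (hβ₀ : β₀ < criticalBeta 3)
    (hii : ∀ β : ℝ, β₀ ≤ β → β < criticalBeta 3 → ∀ A : ℝ, 1 ≤ A →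
      (∑' x : Site 3, if A ^ 2 * msq β < (∑ i, ((x i : ℤ) : ℝ) ^ 2) * chi β
        then twoPointFree 3 β x else 0) ≤ C * Real.exp (-(c₀ * A)) * chi β)
    {ρ₁ ρ₂ : ℝ} (hρ₁ : 0 < ρ₁) (hρ₁₂ : ρ₁ < ρ₂) (hρ₂ : ρ₂ ≤ 1 / 36) :
    ∃ ι > 0, ∀ᶠ β in 𝓝[<] (criticalBeta 3),
      ι ≤ ((nu β) {y : V | ρ₁ ≤ ‖y‖ ∧ ‖y‖ ≤ ρ₂}).toReal := by
  obtain ⟨A, hA1, hann⟩ := nu_annulus_ge hc₀ hii (β₀ := β₀)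
  have hApos : 0 < A := lt_of_lt_of_le one_pos hA1
  have hρ₂0 : 0 < ρ₂ := hρ₁.trans hρ₁₂
  have hd : 0 < ρ₂ - ρ₁ := by linarith
  refine ⟨(ρ₂ - ρ₁) ^ 3 / (27648 * A ^ 5), by positivity, ?_⟩
  -- good `β`: in the window, with `ξ₂` large
  have hξ := tendsto_xi_atTop hc₀ hβ₀ hii
  have hgood : ∀ᶠ β in 𝓝[<] (criticalBeta 3), max β₀ 0 < β ∧ β < criticalBeta 3 := by
    have : Ioo (max β₀ 0) (criticalBeta 3) ∈ 𝓝[<] (criticalBeta 3) :=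
      Ioo_mem_nhdsLT (max_lt hβ₀ (criticalBeta_pos_holds (d := 3) (by norm_num)))
    filter_upwards [this] with β hβ using hβ
  filter_upwards [hgood, hξ.eventually_ge_atTop (max (max 12 (8 / (ρ₂ - ρ₁))) A⁻¹)] with β hβ hξβ
  have hβ0 : 0 < β := lt_of_le_of_lt (le_max_right _ _) hβ.1
  have hβc : β < criticalBeta 3 := hβ.2
  have hββ₀ : β₀ ≤ β := (le_max_left _ _).trans hβ.1.le
  have hχ := chi_pos hβ0.le hβc
  set ξ : ℝ := xi β with hξdef
  have hξpos : 0 < ξ := xi_pos hβ0 hβc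
  have hξ12 : 12 ≤ ξ := ((le_max_left _ _).trans (le_max_left _ _)).trans hξβ
  have hξ8 : 8 / (ρ₂ - ρ₁) ≤ ξ := ((le_max_right _ _).trans (le_max_left _ _)).trans hξβ
  have hξA : A⁻¹ ≤ ξ := (le_max_right _ _).trans hξβ
  have hAξ : 1 ≤ A * ξ := by
    have := mul_le_mul_of_nonneg_left hξA hApos.le; rwa [mul_inv_cancel₀ hApos.ne'] at this
  have hdξ : 8 ≤ (ρ₂ - ρ₁) * ξ := by
    have := (div_le_iff₀ hd).1 hξ8; linarith
  set m : ℝ := twoPointFree 3 β (Pi.single (⟨0, by norm_num⟩ : Fin 3)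
    ((⌈3 * ρ₂ * ξ⌉₊ : ℕ) : ℤ)) with hm
  have hm0 : 0 ≤ m := IsingInputs.G_nonneg hβ0.le _
  set N : ℕ := ⌊A * ξ⌋₊ with hN
  set M : ℕ := ⌊(ρ₂ - ρ₁) * ξ / 8⌋₊ with hM
  -- the two Messager–Miracle-Solé steps
  have hmlow : 1 / (2 * A ^ 2) ≤ (chi β)⁻¹ * ((2 * (N : ℝ) + 1) ^ 3 * m) :=
    (hann β hββ₀ hβ0 hβc).trans (nu_annulus_le_axisValue hβ0 hβc hρ₂0.le hρ₂ hξ12)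
  have hshell := axisValue_le_nu_shell hβ0 hβc hρ₁ hρ₁₂ hdξ
  refine le_trans ?_ hshell
  -- the arithmetic
  have hN3 : 2 * (N : ℝ) + 1 ≤ 3 * (A * ξ) := by
    have : (N : ℝ) ≤ A * ξ := Nat.floor_le (by positivity)
    linarith
  have hMge : (ρ₂ - ρ₁) * ξ / 8 - 1 < M := by
    have := Nat.lt_floor_add_one ((ρ₂ - ρ₁) * ξ / 8); linarith
  have hM8 : (ρ₂ - ρ₁) * ξ / 8 ≤ 2 * (M : ℝ) + 1 := by linarith
  have hq : 0 ≤ (chi β)⁻¹ * m := mul_nonneg (inv_nonneg.2 hχ.le) hm0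
  have hχm : 1 / (2 * A ^ 2) ≤ (chi β)⁻¹ * m * (3 * (A * ξ)) ^ 3 := by
    calc 1 / (2 * A ^ 2) ≤ (chi β)⁻¹ * ((2 * (N : ℝ) + 1) ^ 3 * m) := hmlow
      _ = (chi β)⁻¹ * m * (2 * (N : ℝ) + 1) ^ 3 := by ring
      _ ≤ (chi β)⁻¹ * m * (3 * (A * ξ)) ^ 3 :=
          mul_le_mul_of_nonneg_left (pow_le_pow_left₀ (by positivity) hN3 3) hq
  have h54 : 1 ≤ (chi β)⁻¹ * m * (54 * A ^ 5 * ξ ^ 3) := by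
    rw [div_le_iff₀ (by positivity)] at hχm
    have : (chi β)⁻¹ * m * (3 * (A * ξ)) ^ 3 * (2 * A ^ 2) =
        (chi β)⁻¹ * m * (54 * A ^ 5 * ξ ^ 3) := by ring
    linarith
  have hkey : (ρ₂ - ρ₁) ^ 3 / (27648 * A ^ 5) ≤ (chi β)⁻¹ * m * ((ρ₂ - ρ₁) * ξ / 8) ^ 3 := by
    rw [div_le_iff₀ (by positivity)]
    have e : (chi β)⁻¹ * m * ((ρ₂ - ρ₁) * ξ / 8) ^ 3 * (27648 * A ^ 5) =
        (ρ₂ - ρ₁) ^ 3 * ((chi β)⁻¹ * m * (54 * A ^ 5 * ξ ^ 3)) := by ring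
    rw [e]
    have hp : 0 ≤ (ρ₂ - ρ₁) ^ 3 := by positivity
    nlinarith
  calc (ρ₂ - ρ₁) ^ 3 / (27648 * A ^ 5) ≤ (chi β)⁻¹ * m * ((ρ₂ - ρ₁) * ξ / 8) ^ 3 := hkey
    _ ≤ (chi β)⁻¹ * m * (2 * (M : ℝ) + 1) ^ 3 :=
        mul_le_mul_of_nonneg_left (pow_le_pow_left₀ (by positivity) hM8 3) hq
    _ = (chi β)⁻¹ * ((2 * (M : ℝ) + 1) ^ 3 * m) := by ring

end Summit.CriticalPhenomena.Ising3DConformalLimit.Theorems.HarmonicMomentsIsotropy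

/-! ## The milestone from the route's own cruxes -/

namespace Summit.CriticalPhenomena.Ising3DConformalLimit.HarmonicMomentsIsotropyTwoPoint

open Summit.CriticalPhenomena.Ising3DConformalLimit.Theorems.HarmonicMomentsIsotropy
open Summit.CriticalPhenomena.Ising3DConformalLimit.Theses.HarmonicMomentsIsotropy
open scoped Classical

/-- **`HarmonicDilution → CorrelationLengthWindow → TwoPointAsymptoticIsotropy`** (route decls
verbatim): if every cubic-harmonic anisotropy ratio of the subcritical two-point function on `ℤ³`
tends to `0` as `β ↑ β_c` and the `ξ₂`-window holds, then the critical two-point function is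
asymptotically `O(3)`-invariant in the vague sense.  This is the route's glue `DilutionTransfer`
without the existence crux `ExistsScaleCovariantLimit`: no scaling limit, no reflection positivity
and no regularity hypothesis on `⟨σ₀σ_x⟩_{β_c}` are used (Carleman determinacy of the scaled
subcritical measures, `O(3)`-invariance of their weak limits, Messager–Miracle-Solé, and the window
transfer).  [cite: CampostriniEtAl1998, §2] [cite: MessagerMiracleSoleJSP1977, main theorem (monotonicity of ⟨σ₀σ_x⟩ under reflections)] -/
theorem twoPointAsymptoticIsotropy_of_harmonicDilution_window (hHD : HarmonicDilution)
    (hCLW : CorrelationLengthWindow) : TwoPointAsymptoticIsotropy := by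
  intro φ hφc hφs hφ0 hφpos R
  have hHD' : ∀ (n m : ℕ) (Y : MvPolynomial (Fin 3) ℝ), 1 ≤ n → Y.IsHomogeneous n →
      (∑ i : Fin 3, MvPolynomial.pderiv i (MvPolynomial.pderiv i Y)) = 0 →
      Tendsto (fun β => (∑' x : Site 3, MvPolynomial.eval (fun i => ((x i : ℤ) : ℝ)) Y *
          Real.sqrt (∑ i, ((x i : ℤ) : ℝ) ^ 2) ^ (2 * m) * twoPointFree 3 β x) /
        (∑' x : Site 3, Real.sqrt (∑ i, ((x i : ℤ) : ℝ) ^ 2) ^ (n + 2 * m) * twoPointFree 3 β x))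
        (𝓝[<] (criticalBeta 3)) (𝓝 0) := hHD
  obtain ⟨hi, c₀, C, hc₀, β₀, hβ₀, hii⟩ := hCLW
  change ∀ ε : ℝ, 0 < ε → ∃ s : ℝ, 0 < s ∧ ∃ β₁ : ℝ, β₁ < criticalBeta 3 ∧
      ∀ β : ℝ, β₁ ≤ β → β < criticalBeta 3 → ∀ x : Site 3,
        (∑ i, ((x i : ℤ) : ℝ) ^ 2) * chi β ≤ s * msq β →
          (1 - ε) * criticalTwoPoint 3 x ≤ twoPointFree 3 β x at hi
  change ∀ β : ℝ, β₀ ≤ β → β < criticalBeta 3 → ∀ A : ℝ, 1 ≤ A →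
      (∑' x : Site 3, if A ^ 2 * msq β < (∑ i, ((x i : ℤ) : ℝ) ^ 2) * chi β
        then twoPointFree 3 β x else 0) ≤ C * Real.exp (-(c₀ * A)) * chi β at hii
  -- the core with the window scale `s₁ = 1/1296`: cubes with `9(‖w‖+r)² ≤ s₁` have `3(‖w‖+r) ≤ 1/36`
  have hs₁ : (0 : ℝ) < 1 / 1296 := by norm_num
  refine tendsto_ratio_of_dilution_core hHD' hi hc₀ hβ₀ hii hs₁ (fun w r hr hrw hws => ?_)
    hφc hφs hφ0 hφpos R
  -- the shell through the middle of the cube is charged (window alone), hence the cube is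
  set R₀ : ℝ := ‖(WithLp.toLp 2 w : V)‖ with hR₀
  have hwsup : ‖w‖ ≤ R₀ := norm_ofLp_le (WithLp.toLp 2 w : V)
  have hR₀le : R₀ ≤ 2 * ‖w‖ := by
    have h3 : R₀ ^ 2 ≤ 3 * ‖w‖ ^ 2 := by
      rw [hR₀, EuclideanSpace.norm_eq, Real.sq_sqrt (Finset.sum_nonneg fun _ _ => sq_nonneg _)]
      refine le_trans (le_of_eq ?_) (sum_sq_le_three_mul_norm_sq w)
      simp
    nlinarith [norm_nonneg (WithLp.toLp 2 w : V), norm_nonneg w]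
  have hsum : ‖w‖ + r ≤ 1 / 108 := by
    have h0 : 0 ≤ ‖w‖ + r := by positivity
    nlinarith
  obtain ⟨ι₀, hι₀, hshell⟩ := nu_shell_charge_of_window hc₀ hβ₀ hii (ρ₁ := R₀ - r / 2)
    (ρ₂ := R₀ + r / 2) (by linarith) (by linarith) (by linarith)
  exact nu_cube_charge_of_nu_shell hHD' hc₀ hβ₀ hii w hr hrw hι₀ hshell

/-- **The milestone from the route's two own cruxes:
`AngularHierarchy → CorrelationLengthWindow → TwoPointAsymptoticIsotropy`** (route decls verbatim;
`AngularHierarchy` = item stmt-CriticalPhenomena-6031, rank 2; `CorrelationLengthWindow` = item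
6032, rank 3), through the accepted `hierarchyClosure_proof : HierarchyClosure` (item 6035:
`AngularHierarchy → HarmonicDilution`).  For the isotropy milestone the route HarmonicMomentsIsotropy
therefore needs none of the shared cruxes (`ExistsScaleCovariantLimit`, `InversionUpgradeNormalised`,
`IsingEuclidUpgradeR4NonGaussian`) and no `RotationUpgrade`. [cite: CampostriniEtAl1998, §2] -/
theorem twoPointAsymptoticIsotropy_of_angularHierarchy_window (hAH : AngularHierarchy)
    (hCLW : CorrelationLengthWindow) : TwoPointAsymptoticIsotropy :=
  twoPointAsymptoticIsotropy_of_harmonicDilution_window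
    (_root_.Summit.CriticalPhenomena.Ising3DConformalLimit.Theorems.hierarchyClosure_proof hAH) hCLW

end Summit.CriticalPhenomena.Ising3DConformalLimit.HarmonicMomentsIsotropyTwoPoint

end
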